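import Summits.MatrixMultiplication.MatrixMultiplication.Theses.LevelGradedCohnUmans
import Summits.MatrixMultiplication.MatrixMultiplication.Theorems.LevelGradedCohnUmansTokenBudget

/-!
# `SnEngineLink` — the `𝔖ₙ` engine is load-bearing: `SnLevelDesigns → GradedDesignFamily`

Route `MatrixMultiplication/LevelGradedCohnUmans`, support item `stmt-MatrixMultiplication-14051`
(`Summit.MatrixMultiplication.MatrixMultiplication.Theses.LevelGradedCohnUmans.SnEngineLink`).

Given `ε > 0` and the `𝔖ₙ` witness `(n, k, X, Y, Z)` of `SnLevelDesigns` (a `k`-token separated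
triple whose volume beats the partition budget `∑_{μ ⊢ n, μ₁ ≥ n-k} (f^μ)^(2+ε)`), the graded design
is `G = 𝔖ₙ` with the `k`-token test space
`J_k = {g ↦ ∑_{p : [k] → [n]} c_p (g ∘ p)} ≤ ℂ^{𝔖ₙ}`:

* `J_k` is a subspace (coefficients `0`, `c + c'`, `a • c`) and is bi-invariant:
  `f(a g b) = ∑_p c_p (a ∘ g ∘ b ∘ p) = ∑_q c_{b⁻¹ ∘ q} (a ∘ (g ∘ q))` (reindex `q = b ∘ p`), again a
  `k`-token function with coefficients `c'_q(h) = c_{b⁻¹ q}(a ∘ h)`;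
* the `k`-token separator of a target `(x₀, z₀)` is a `J_k`-separator verbatim;
* the graded budget `∑ᶠ_{χ ∈ Irr(𝔖ₙ) ∩ J_k} χ(1)^(2+ε)` is at most the partition sum by the landed
  route item `TokenBudget` (`tokenBudget_proof`, Young's rule in the pricing direction,
  Ellis–Friedgut–Pilpel 2011 Thm. 7) at `s = 2 + ε`, hence below `(|X||Y||Z|)^((2+ε)/3)`.
-/

-- single-conjunct summit: the mandated namespace `Summit.MatrixMultiplication.MatrixMultiplication.…`
-- repeats `MatrixMultiplication` (summit = sub-problem), which `linter.dupNamespace` would flag.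
set_option linter.dupNamespace false

noncomputable section

open scoped BigOperators
open Literature.RepresentationTheory.FiniteGroups

namespace Summit.MatrixMultiplication.MatrixMultiplication.Theorems

variable {n k : ℕ}

/-- **Bi-invariance of the `k`-token functions** (reindexing): for coefficients
`c : ([k] → [n]) → ([k] → [n]) → ℂ` and `a b g ∈ 𝔖ₙ`,
`∑_p c_p ((a g b) ∘ p) = ∑_q c_{b⁻¹ ∘ q} (a ∘ (g ∘ q))` (substitute `q = b ∘ p`). [folklore] -/
theorem sum_tokenCoeff_mul_mul (c : (Fin k → Fin n) → (Fin k → Fin n) → ℂ)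
    (a b g : Equiv.Perm (Fin n)) :
    ∑ p : Fin k → Fin n, c p (⇑(a * g * b) ∘ p) =
      ∑ q : Fin k → Fin n, c (⇑b⁻¹ ∘ q) (⇑a ∘ (⇑g ∘ q)) := by
  refine Fintype.sum_equiv ((Equiv.refl (Fin k)).arrowCongr b) _ _ (fun p => ?_)
  have h1 : (⇑b⁻¹ ∘ ((Equiv.refl (Fin k)).arrowCongr b p)) = p := by
    funext i
    simp [Equiv.arrowCongr_apply]
  have h2 : (⇑a ∘ (⇑g ∘ ((Equiv.refl (Fin k)).arrowCongr b p))) = (⇑(a * g * b) ∘ p) := by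
    funext i
    simp [Equiv.arrowCongr_apply]
  rw [h1, h2]

/-- **`SnEngineLink`** (settles `stmt-MatrixMultiplication-14051`, exact route signature
`Summit.MatrixMultiplication.MatrixMultiplication.Theses.LevelGradedCohnUmans.SnEngineLink`):
`SnLevelDesigns → GradedDesignFamily`.  For the `𝔖ₙ` witness `(n, k, X, Y, Z)` at `ε` take
`G = 𝔖ₙ` and `J = J_k`, the `k`-token test space; `J_k` is a bi-invariant subspace
(`sum_tokenCoeff_mul_mul`), the `k`-token separators are `J_k`-separators verbatim, and the graded
budget is bounded by the partition sum of `SnLevelDesigns` via `TokenBudget` (`tokenBudget_proof`)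
at `s = 2 + ε`. [folklore] -/
theorem snEngineLink_proof :
    Summit.MatrixMultiplication.MatrixMultiplication.Theses.LevelGradedCohnUmans.SnEngineLink := by
  unfold Summit.MatrixMultiplication.MatrixMultiplication.Theses.LevelGradedCohnUmans.SnEngineLink
  intro hSn ε hε
  obtain ⟨n, k, X, Y, Z, hsep, hbudget⟩ := hSn ε hε
  classical
  -- the `k`-token test space `J_k` as a submodule of `𝔖ₙ → ℂ`, remembered through its carrier
  obtain ⟨J, hJ⟩ : ∃ J : Submodule ℂ (Equiv.Perm (Fin n) → ℂ), (J : Set (Equiv.Perm (Fin n) → ℂ)) =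
      {f | ∃ c : (Fin k → Fin n) → (Fin k → Fin n) → ℂ,
        ∀ g : Equiv.Perm (Fin n), f g = ∑ p : Fin k → Fin n, c p (⇑g ∘ p)} :=
    ⟨{ carrier := {f | ∃ c : (Fin k → Fin n) → (Fin k → Fin n) → ℂ,
          ∀ g : Equiv.Perm (Fin n), f g = ∑ p : Fin k → Fin n, c p (⇑g ∘ p)}
       zero_mem' := ⟨fun _ _ => 0, fun g => by simp⟩
       add_mem' := by
         rintro f f' ⟨c, hc⟩ ⟨c', hc'⟩
         exact ⟨fun p q => c p q + c' p q, fun g => by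
           simp only [Pi.add_apply, hc, hc', Finset.sum_add_distrib]⟩
       smul_mem' := by
         rintro a f ⟨c, hc⟩
         exact ⟨fun p q => a * c p q, fun g => by
           simp only [Pi.smul_apply, smul_eq_mul, hc, Finset.mul_sum]⟩ }, rfl⟩
  refine ⟨Equiv.Perm (Fin n), inferInstance, inferInstance, J, X, Y, Z, ?_, ?_, ?_⟩
  · -- bi-invariance of `J_k`
    intro f hf a b
    rw [← SetLike.mem_coe, hJ] at hf ⊢
    obtain ⟨c, hc⟩ := hf
    refine ⟨fun q h => c (⇑b⁻¹ ∘ q) (⇑a ∘ h), fun g => ?_⟩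
    simp only [hc]
    exact sum_tokenCoeff_mul_mul c a b g
  · -- the `k`-token separators are `J_k`-separators
    intro x₀ hx₀ z₀ hz₀
    obtain ⟨c, hc⟩ := hsep x₀ hx₀ z₀ hz₀
    refine ⟨fun g => ∑ p : Fin k → Fin n, c p (⇑g ∘ p), ?_, ?_⟩
    · rw [← SetLike.mem_coe, hJ]
      exact ⟨c, fun g => rfl⟩
    · intro x hx y hy y' hy' z hz
      have h := hc x hx y hy y' hy' z hz
      refine ⟨fun heq => ?_, fun hne => ?_⟩
      · show (∑ p : Fin k → Fin n, c p (⇑(x⁻¹ * y * y'⁻¹ * z) ∘ p)) = 1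
        rw [h, if_pos heq]
      · show (∑ p : Fin k → Fin n, c p (⇑(x⁻¹ * y * y'⁻¹ * z) ∘ p)) = 0
        rw [h, if_neg hne]
  · -- graded budget ≤ partition budget (`TokenBudget` at `s = 2 + ε`) < volume^((2+ε)/3)
    rw [hJ]
    exact lt_of_le_of_lt (tokenBudget_proof n k (2 + ε)) hbudget

end Summit.MatrixMultiplication.MatrixMultiplication.Theorems

end
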